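import Literature.Claims.NS.ClayPeriodicBlowupAlternative
import Literature.Analysis.FluidPDE.TorusNSEnstrophyContinuation
import Literature.Analysis.FluidPDE.TorusBKMGradientLogBound
import Literature.Analysis.FunctionSpaces.TorusSupNormContinuity
import HarnessLib

/-!
# Clay (B)/(D) reference — the `L^∞` (Serrin `s = ∞`) and vorticity forms: (B) ⇔ an a priori
# VELOCITY bound, (B) ⇔ an a priori VORTICITY bound, for periodic classical solutions;
# printed-(10) solvability fails iff the velocity blows up

Companion to `ClayPeriodicBlowupAlternative.lean` ((B) ⇔ a priori GRADIENT bound, via the torus maximal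
solution with the enstrophy alternative) and `ClayPeriodicSupBlowupCertificate.lean` (velocity / gradient /
vorticity sup-norm certificates ⇒ (D)). The tree's torus continuation criteria
`Torus.classicalNS_continuation_of_velocitySup_sq_integral_le` (Serrin's class `L²(0,T; L^∞)`,
Robinson–Rodrigo–Sadowski 2016 Thm. 8.17 with Lemma 8.16; mean-zero slices) and
`Torus.classicalNS_bkm_continuation_anyMean` (Beale–Kato–Majda on `𝕋³`, any mean) continue a classical
solution with bounded velocity, resp. bounded vorticity, past the end of its slab; combined with the
maximality clause of `clayPeriodic_solvable_or_gradientSupBlowup` this upgrades the gradient in that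
file's statements to the velocity or the vorticity:

* `torus_classicalNS_continuation_of_velocityBound_anyMean` — a classical torus solution on `[0, T)`
  (any mean, `ν > 0`) with `‖u‖ ≤ M` on `[0, T) × 𝕋³` continues to a classical solution on some closed
  `[0, T']`, `T' > T`, equal to `u` on `[0, T)` (Galilean reduction to the mean-zero theorem, as in the
  tree's `Torus.classicalNS_bkm_continuation_anyMean`);
* `not_clayPeriodic_solvable_iff_exists_velocitySupBlowup` — printed-(10) solvability of `(ν, 0, u₀)`
  FAILS ⇔ some `u`,`p`-periodic classical solution from `u₀` on a half-open slab has unbounded velocity;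
* `clayPeriodic_regularityAt_iff_aprioriVelocityBound` / `clayPeriodic_regularity_iff_aprioriVelocityBound(_at)`
  — **(B) ⇔ every `u`,`p`-periodic classical solution of the unforced system on a half-open slab
  `[0, T) × ℝ³` from a smooth divergence-free `ℤ³`-periodic datum has BOUNDED velocity**;
* `clayPeriodic_regularityAt_iff_aprioriVorticityBound` / `clayPeriodic_regularity_iff_aprioriVorticityBound(_at)`
  — **(B) ⇔ every such solution has bounded vorticity**, the vorticity rendered as the torus quantity
  `torusVorticitySqAt` (`= Σₗ (curl u)ₗ²`, `torusVorticitySqAt_eq_sum_curl_sq`) of the descended slices.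

* (rev 2) `clayPeriodic_solvable_of_aprioriCurlBound_datum`, `clayPeriodic_solvable_of_aprioriVelocityBound_datum`
  (per-datum doors), `clayPeriodic_regularityAt_iff_aprioriCurlBound` / `…_at` — the vorticity form with
  the `ℝ³` curl `‖curl (u t) x‖ ≤ M` of the periodic field itself (`Torus.norm_curl_lift_sq`).
* (rev 3) **(B) ⇔ the a priori Beale–Kato–Majda TIME-INTEGRAL bound** —
  `clayPeriodic_regularityAt_iff_aprioriBKM` / `clayPeriodic_regularity_iff_aprioriBKM(_at)` (every
  `u`,`p`-periodic classical solution on `[0, T) × ℝ³` from a smooth divergence-free periodic datum has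
  `∫₀ᵀ sup_x |curl u(t,x)| dt < ∞`, the lower integral of the `[0,∞]`-valued supremum — the periodic twin
  of `clayR3_regularityAt_iff_aprioriBKM`), the per-datum doors `clayPeriodic_solvable_of_aprioriBKMMajorant_datum`
  (continuous majorant `M ≥ |curl u|` with `∫₀ᵗ M ≤ I`, Robinson–Rodrigo–Sadowski Thm 12.3 as rendered by
  `Torus.classicalNS_bkm_continuation_anyMean`) and `clayPeriodic_solvable_of_aprioriBKM_datum`, the bridge
  `exists_vorticityMajorant_of_lintegral_ne_top` (finite BKM integral ⇒ the continuous majorant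
  `‖curl u(t)‖_{L^∞(𝕋³)}`, `Torus.IsSmoothSpaceTimeOn.continuousOn_toReal_eSupNorm`),
  `not_clayPeriodic_solvable_iff_exists_bkmBlowup`, and the (D)-certificates
  `not_clayPeriodic_solvable_of_vorticityIntegralCertificate` /
  `navierStokesBreakdownPeriodic_of_vorticityIntegralCertificate` (`∫₀ᵀ sup_x |curl u| = ∞` along one
  periodic classical solution from a periodic datum proves (D)).

Usage on a CARD (§3, periodic REG rows): a printed a priori `max |u|` bound (or `max |ω|` bound, or a bound on
BKM's `∫₀ᵀ ‖ω‖_∞`) for smooth periodic solutions IS (B) — cite `clayPeriodic_regularity_iff_aprioriVelocityBound` /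
`…VorticityBound` / `…_iff_aprioriBKM`; a printed `∫₀ᵀ ‖ω‖_∞ = ∞` for ONE periodic smooth solution from a
periodic datum IS (D) — cite `navierStokesBreakdownPeriodic_of_vorticityIntegralCertificate`; remaining deltas as in `ClayPeriodicBlowupAlternative.lean` (Δ5 pressure periodicity,
Δ1 period, Δ3 forcing).

## References

* C. L. Fefferman, CMI 2006, (B), (D) with (8)–(11) p. 2. [FeffermanClay2006]
* J. C. Robinson, J. L. Rodrigo, W. Sadowski, CUP 2016, Thm. 8.17 with Lemma 8.16 (`r = 2`, `s = ∞`),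
  Thm. 12.3, §6.3, §8.1. [RobinsonRodrigoSadowskiCUP2016]
* J. T. Beale, T. Kato, A. Majda, Comm. Math. Phys. 94 (1984), Thm. 1. [BealeKatoMajda1984]

WHAT THIS IS NOT: not a claim about NS regularity or blow-up; not a claim about any author beyond
the typed locator.
-/

open scoped ContDiff ENNReal Topology

namespace Literature.Claims.NS.ClayVariants

open Set Filter MeasureTheory Function Literature.Analysis Literature.Analysis.FluidPDE
  Literature.Analysis.FunctionSpaces

noncomputable section

/-! ## Torus continuation under a velocity bound, any mean -/

/-- **A bounded classical torus solution continues past the end of its slab, any mean** (Serrin's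
`L²(0,T;L^∞)` continuation on `𝕋³`, Robinson–Rodrigo–Sadowski 2016 Thm. 8.17 / Lemma 8.16, by Galilean
reduction to the tree's mean-zero theorem `Torus.classicalNS_continuation_of_velocitySup_sq_integral_le`:
boost by the (constant) mean `m`, the boosted velocity is bounded by `M + ‖m‖`, continue, boost back).
[cite: RobinsonRodrigoSadowskiCUP2016, Thm 8.17 with Lemma 8.16 (case r = 2, s = ∞) and §1.8] -/
theorem torus_classicalNS_continuation_of_velocityBound_anyMean {ν T : ℝ} (hν : 0 < ν) (hT : 0 < T)
    {U : ℝ → UnitAddTorus (Fin 3) → EuclideanSpace ℝ (Fin 3)} {P : ℝ → UnitAddTorus (Fin 3) → ℝ}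
    (h : Torus.IsClassicalNSSolutionOn (Ico 0 T) ν 0 U P) {M : ℝ}
    (hM : ∀ t ∈ Ico 0 T, ∀ x, ‖U t x‖ ≤ M) :
    ∃ T' : ℝ, T < T' ∧ ∃ (U' : ℝ → UnitAddTorus (Fin 3) → EuclideanSpace ℝ (Fin 3))
      (P' : ℝ → UnitAddTorus (Fin 3) → ℝ), Torus.IsClassicalNSSolutionOn (Icc 0 T') ν 0 U' P' ∧
        ∀ t ∈ Ico 0 T, U' t = U t := by
  have h0S : (0 : ℝ) ∈ Ico 0 T := ⟨le_rfl, hT⟩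
  have hM0 : 0 ≤ M := (norm_nonneg _).trans (hM 0 h0S (Torus.proj 0))
  set m : EuclideanSpace ℝ (Fin 3) := ∫ y, U 0 y with hm
  have hmean : ∀ t ∈ Ico 0 T, ∫ y, U t y = m := fun t ht =>
    h.integral_velocity_eq (convex_Ico 0 T) (fun τ _ => by simp) h0S ht
  clear_value m
  have hv := Torus.isClassicalNSSolutionOn_galileanBoost (uniqueDiffOn_Ico 0 T) h m
  have hvmean : ∀ t ∈ Ico 0 T, Torus.HasZeroMean (fun x => U t (x + Torus.proj (t • m)) - m) := by
    intro t ht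
    unfold Torus.HasZeroMean
    rw [Torus.integral_comp_add_right_sub_const (h.smooth_velocity.isSmooth_slice ht).integrable,
      hmean t ht, sub_self]
  have hN : ∀ t ∈ Ico 0 T, ∀ x, ‖U t (x + Torus.proj (t • m)) - m‖ ≤ M + ‖m‖ := by
    intro t ht x
    have h1 : ‖U t (x + Torus.proj (t • m))‖ ≤ M := hM t ht _
    have h2 := norm_sub_le (U t (x + Torus.proj (t • m))) m
    linarith
  have hI : ∀ t ∈ Ico 0 T, ∫ _s in (0 : ℝ)..t, (M + ‖m‖) ^ 2 ≤ (M + ‖m‖) ^ 2 * T := by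
    intro t ht
    rw [intervalIntegral.integral_const, smul_eq_mul, sub_zero, mul_comm]
    exact mul_le_mul_of_nonneg_left ht.2.le (sq_nonneg _)
  obtain ⟨T', hTT', v', q', hv', -, hagree⟩ :=
    Torus.classicalNS_continuation_of_velocitySup_sq_integral_le (d := Fin 3) (by simp) hν hT hv hvmean
      (N := fun _ => M + ‖m‖) continuousOn_const (fun _ _ => add_nonneg hM0 (norm_nonneg m)) hN hI
  refine ⟨T', hTT', fun t x => v' t (x + Torus.proj (t • (-m))) - (-m),
    fun t x => q' t (x + Torus.proj (t • (-m))),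
    Torus.isClassicalNSSolutionOn_galileanBoost (uniqueDiffOn_Icc (hT.trans hTT')) hv' (-m),
    fun t ht => ?_⟩
  funext x
  show v' t (x + Torus.proj (t • (-m))) - (-m) = U t x
  rw [hagree t ht]
  show U t (x + Torus.proj (t • (-m)) + Torus.proj (t • m)) - m - (-m) = U t x
  rw [add_assoc, ← Torus.proj_add, ← smul_add, neg_add_cancel, smul_zero, Torus.proj_zero, add_zero,
    sub_neg_eq_add, sub_add_cancel]

/-! ## Printed-(10) solvability fails iff the velocity blows up -/

variable {ν : ℝ} {u₀ : EuclideanSpace ℝ (Fin 3) → EuclideanSpace ℝ (Fin 3)}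

/-- A continuation past `T*` of the maximal periodic solution contradicts its maximality (plumbing used
twice below): if `(u, p)` is `u`,`p`-periodic classical on `[0, T*)` from `u₀` with the maximality clause
of `clayPeriodic_solvable_or_gradientSupBlowup`, then no torus classical solution on a closed `[0, T']`,
`T' > T*`, agrees with the descended `u` on `[0, T*)`. [cite: RobinsonRodrigoSadowskiCUP2016, §6.3, §8.1] -/
private theorem false_of_torus_continuation {Ts T' : ℝ} (hTs : 0 < Ts) (hT' : Ts < T')
    {u : ℝ → EuclideanSpace ℝ (Fin 3) → EuclideanSpace ℝ (Fin 3)}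
    (hu0 : u 0 = u₀) (hper₀ : IsLatticePeriodic u₀)
    (hmax : ∀ (b : ℝ) (v : ℝ → EuclideanSpace ℝ (Fin 3) → EuclideanSpace ℝ (Fin 3))
      (q : ℝ → EuclideanSpace ℝ (Fin 3) → ℝ),
      FluidPDE.IsClassicalNSSolutionOn (Icc 0 b) ν 0 v q → v 0 = u₀ →
      (∀ t ∈ Icc 0 b, IsLatticePeriodic (v t) ∧ IsLatticePeriodic (q t)) →
        b < Ts ∧ ∀ s ∈ Icc 0 b, v s = u s)
    {U' : ℝ → UnitAddTorus (Fin 3) → EuclideanSpace ℝ (Fin 3)} {P' : ℝ → UnitAddTorus (Fin 3) → ℝ}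
    (hU' : Torus.IsClassicalNSSolutionOn (Icc 0 T') ν 0 U' P')
    (hagree : ∀ t ∈ Ico 0 Ts, U' t = fun x => u t (Torus.repr x)) : False := by
  obtain ⟨hclR, hperR⟩ := periodic_lift_of_torus hU'
  have h0 : Torus.lift (U' 0) = u₀ := by
    rw [hagree 0 ⟨le_rfl, hTs⟩, hu0]
    exact Torus.lift_descend_holds u₀ hper₀
  have hb := (hmax T' _ _ hclR h0 fun t _ => hperR t).1
  exact absurd hb (not_lt.2 hT'.le)

/-- **Printed-(10) solvability of one periodic Cauchy problem fails iff its classical solution blows up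
in VELOCITY sup norm in finite time**: for `ν > 0` and `u₀` smooth divergence free `ℤ³`-periodic,
`¬ clayPeriodic.Solvable ν 0 u₀ ↔ ∃ T > 0, ∃ (u, p)` classical on `[0, T) × ℝ³`, `u 0 = u₀`, `u(·,t)`,
`p(·,t)` periodic, `|u|` unbounded on `[0, T) × ℝ³`. ((⇒): the maximal solution of
`clayPeriodic_solvable_or_gradientSupBlowup` cannot stay bounded — a bound would continue it past `T*`
(`torus_classicalNS_continuation_of_velocityBound_anyMean`), against maximality; (⇐) is
`not_clayPeriodic_solvable_of_velocitySupCertificate`.)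
[cite: FeffermanClay2006, (B) (D) with (8) (10) (11) p. 2] [cite: RobinsonRodrigoSadowskiCUP2016, Thm 8.17 (r = 2, s = ∞), §6.3, §8.1] -/
theorem not_clayPeriodic_solvable_iff_exists_velocitySupBlowup (hν : 0 < ν) (hu₀ : ContDiff ℝ ∞ u₀)
    (hdiv : NSWave0.IsDivFree u₀) (hper : IsLatticePeriodic u₀) :
    ¬ clayPeriodic.Solvable ν 0 u₀ ↔
      ∃ T : ℝ, 0 < T ∧
        ∃ (u : ℝ → EuclideanSpace ℝ (Fin 3) → EuclideanSpace ℝ (Fin 3))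
          (p : ℝ → EuclideanSpace ℝ (Fin 3) → ℝ),
          FluidPDE.IsClassicalNSSolutionOn (Ico 0 T) ν 0 u p ∧ u 0 = u₀ ∧
          (∀ t ∈ Ico 0 T, IsLatticePeriodic (u t) ∧ IsLatticePeriodic (p t)) ∧
          ∀ M : ℝ, ∃ t ∈ Ico 0 T, ∃ x : EuclideanSpace ℝ (Fin 3), M < ‖u t x‖ := by
  constructor
  · intro hno
    rcases clayPeriodic_solvable_or_gradientSupBlowup hν hu₀ hdiv hper with
      hsol | ⟨Ts, hTs, u, p, hcl, hu0, hperT, -, -, hmax⟩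
    · exact absurd hsol hno
    · refine ⟨Ts, hTs, u, p, hcl, hu0, hperT, fun M => ?_⟩
      by_contra hbd
      push Not at hbd
      -- descend to the torus and continue past `T*` under the velocity bound
      obtain ⟨hU, -⟩ := torus_descend_of_periodic hcl hperT
      obtain ⟨T', hT', U', P', hU', hagree⟩ :=
        torus_classicalNS_continuation_of_velocityBound_anyMean hν hTs hU (M := M)
          fun t ht x => hbd t ht (Torus.repr x)
      exact false_of_torus_continuation hTs hT' hu0 hper hmax hU' hagree
  · rintro ⟨T, -, u, p, hcl, hu0, hperT, hb⟩
    exact not_clayPeriodic_solvable_of_velocitySupCertificate hν.le hcl hu0 hperT hb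

/-! ## (B) ⇔ the a priori velocity bound -/

/-- **(B) at one viscosity ⇔ the a priori VELOCITY bound** (`μ > 0`): `clayPeriodic.RegularityAt μ` ⇔
every classical solution of the unforced system on a half-open slab `[0, T) × ℝ³` from a smooth
divergence-free `ℤ³`-periodic datum, with `u(·,t)` and `p(·,t)` periodic, has BOUNDED velocity on
`[0, T) × ℝ³` ((⇒) `exists_bounds_of_clayPeriodic_solvable`; (⇐) `not_clayPeriodic_solvable_iff_exists_velocitySupBlowup`).
[cite: FeffermanClay2006, (B) with (8) (10) (11) p. 2] [cite: RobinsonRodrigoSadowskiCUP2016, Thm 8.17 (r = 2, s = ∞), §6.3, §8.1] -/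
theorem clayPeriodic_regularityAt_iff_aprioriVelocityBound {μ : ℝ} (hμ : 0 < μ) :
    clayPeriodic.RegularityAt μ ↔
      ∀ (u₀ : EuclideanSpace ℝ (Fin 3) → EuclideanSpace ℝ (Fin 3)), ContDiff ℝ ∞ u₀ →
        NSWave0.IsDivFree u₀ → IsLatticePeriodic u₀ →
        ∀ (T : ℝ) (u : ℝ → EuclideanSpace ℝ (Fin 3) → EuclideanSpace ℝ (Fin 3))
          (p : ℝ → EuclideanSpace ℝ (Fin 3) → ℝ),
          FluidPDE.IsClassicalNSSolutionOn (Ico 0 T) μ 0 u p → u 0 = u₀ →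
          (∀ t ∈ Ico 0 T, IsLatticePeriodic (u t) ∧ IsLatticePeriodic (p t)) →
            ∃ M : ℝ, ∀ t ∈ Ico 0 T, ∀ x : EuclideanSpace ℝ (Fin 3), ‖u t x‖ ≤ M := by
  constructor
  · intro hreg u₀ hu₀ hdiv hper T u p hcl hu0 hperT
    exact (exists_bounds_of_clayPeriodic_solvable hμ.le hcl hu0 hperT (hreg u₀ hu₀ hdiv hper)).1
  · intro hbd u₀ hu₀ hdiv hper
    by_contra hno
    obtain ⟨T, -, u, p, hcl, hu0, hperT, hb⟩ :=
      (not_clayPeriodic_solvable_iff_exists_velocitySupBlowup hμ hu₀ hdiv hper).1 hno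
    obtain ⟨M, hM⟩ := hbd u₀ hu₀ hdiv hper T u p hcl hu0 hperT
    obtain ⟨t, ht, x, hMx⟩ := hb M
    exact absurd hMx (not_lt.2 (hM t ht x))

/-- **(B) ⇔ the a priori velocity bound at every viscosity.**
[cite: FeffermanClay2006, (B) with (8) (10) (11) p. 2] [cite: RobinsonRodrigoSadowskiCUP2016, Thm 8.17 (r = 2, s = ∞)] -/
theorem clayPeriodic_regularity_iff_aprioriVelocityBound :
    clayPeriodic.Regularity ↔
      ∀ μ : ℝ, 0 < μ →
      ∀ (u₀ : EuclideanSpace ℝ (Fin 3) → EuclideanSpace ℝ (Fin 3)), ContDiff ℝ ∞ u₀ →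
        NSWave0.IsDivFree u₀ → IsLatticePeriodic u₀ →
        ∀ (T : ℝ) (u : ℝ → EuclideanSpace ℝ (Fin 3) → EuclideanSpace ℝ (Fin 3))
          (p : ℝ → EuclideanSpace ℝ (Fin 3) → ℝ),
          FluidPDE.IsClassicalNSSolutionOn (Ico 0 T) μ 0 u p → u 0 = u₀ →
          (∀ t ∈ Ico 0 T, IsLatticePeriodic (u t) ∧ IsLatticePeriodic (p t)) →
            ∃ M : ℝ, ∀ t ∈ Ico 0 T, ∀ x : EuclideanSpace ℝ (Fin 3), ‖u t x‖ ≤ M :=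
  ⟨fun h μ hμ => (clayPeriodic_regularityAt_iff_aprioriVelocityBound hμ).1 (h μ hμ),
    fun h μ hμ => (clayPeriodic_regularityAt_iff_aprioriVelocityBound hμ).2 (h μ hμ)⟩

/-- **(B) ⇔ the a priori velocity bound at ONE viscosity `μ > 0`.**
[cite: FeffermanClay2006, (B) p. 2] [cite: Tao2013Localisation, Rem. 1.2 footnote] -/
theorem clayPeriodic_regularity_iff_aprioriVelocityBound_at {μ : ℝ} (hμ : 0 < μ) :
    clayPeriodic.Regularity ↔
      ∀ (u₀ : EuclideanSpace ℝ (Fin 3) → EuclideanSpace ℝ (Fin 3)), ContDiff ℝ ∞ u₀ →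
        NSWave0.IsDivFree u₀ → IsLatticePeriodic u₀ →
        ∀ (T : ℝ) (u : ℝ → EuclideanSpace ℝ (Fin 3) → EuclideanSpace ℝ (Fin 3))
          (p : ℝ → EuclideanSpace ℝ (Fin 3) → ℝ),
          FluidPDE.IsClassicalNSSolutionOn (Ico 0 T) μ 0 u p → u 0 = u₀ →
          (∀ t ∈ Ico 0 T, IsLatticePeriodic (u t) ∧ IsLatticePeriodic (p t)) →
            ∃ M : ℝ, ∀ t ∈ Ico 0 T, ∀ x : EuclideanSpace ℝ (Fin 3), ‖u t x‖ ≤ M := by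
  rw [← ClaySpec.regularityAt_iff_regularity hμ clayPeriodic_data_smul
    clayPeriodic_admissible_timeRescale]
  exact clayPeriodic_regularityAt_iff_aprioriVelocityBound hμ

/-! ## (B) ⇔ the a priori vorticity bound (torus vorticity of the descended slices) -/

/-- **(B) at one viscosity ⇔ the a priori VORTICITY bound** (`μ > 0`): `clayPeriodic.RegularityAt μ` ⇔
every `u`,`p`-periodic classical solution on a half-open slab from a smooth divergence-free periodic datum
has bounded vorticity, `|ω(t,x)|² = torusVorticitySqAt (u(t) ∘ repr) ≤ Ω²` on `[0, T) × 𝕋³`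
((⇒) the gradient bound of `exists_bounds_of_clayPeriodic_solvable` and `|ω|² ≤ 2|∇u|²_F`,
`torusVorticitySqAt_le_two_mul_sum_norm_sq`; (⇐) the maximal solution would continue past `T*` by the
tree's torus BKM theorem `Torus.classicalNS_bkm_continuation_anyMean`).
[cite: FeffermanClay2006, (B) with (8) (10) (11) p. 2] [cite: BealeKatoMajda1984, Thm 1] [cite: RobinsonRodrigoSadowskiCUP2016, Thm 12.3, §6.3, §8.1] -/
theorem clayPeriodic_regularityAt_iff_aprioriVorticityBound {μ : ℝ} (hμ : 0 < μ) :
    clayPeriodic.RegularityAt μ ↔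
      ∀ (u₀ : EuclideanSpace ℝ (Fin 3) → EuclideanSpace ℝ (Fin 3)), ContDiff ℝ ∞ u₀ →
        NSWave0.IsDivFree u₀ → IsLatticePeriodic u₀ →
        ∀ (T : ℝ) (u : ℝ → EuclideanSpace ℝ (Fin 3) → EuclideanSpace ℝ (Fin 3))
          (p : ℝ → EuclideanSpace ℝ (Fin 3) → ℝ),
          FluidPDE.IsClassicalNSSolutionOn (Ico 0 T) μ 0 u p → u 0 = u₀ →
          (∀ t ∈ Ico 0 T, IsLatticePeriodic (u t) ∧ IsLatticePeriodic (p t)) →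
            ∃ Ω : ℝ, ∀ t ∈ Ico 0 T, ∀ x : UnitAddTorus (Fin 3),
              torusVorticitySqAt (fun y => u t (Torus.repr y)) x ≤ Ω ^ 2 := by
  constructor
  · intro hreg u₀ hu₀ hdiv hper T u p hcl hu0 hperT
    obtain ⟨-, D, hD⟩ := exists_bounds_of_clayPeriodic_solvable hμ.le hcl hu0 hperT (hreg u₀ hu₀ hdiv hper)
    obtain ⟨hU, hlift⟩ := torus_descend_of_periodic hcl hperT
    refine ⟨Real.sqrt (2 * (3 * D ^ 2)), fun t ht x => ?_⟩
    have hUt : Torus.IsSmooth (fun y => u t (Torus.repr y)) := hU.smooth_velocity.isSmooth_slice ht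
    have hg1 : Torus.IsContDiff 1 (fun y => u t (Torus.repr y)) :=
      hUt.isContDiff (n := 1) (by exact_mod_cast le_top)
    -- each partial derivative of the descended slice is a directional value of `∇u(t)`
    have hpt : ∀ i : Fin 3, ‖Torus.partialDeriv i (fun y => u t (Torus.repr y)) x‖ ≤ D := by
      intro i
      have h1 := congrFun (Torus.lift_partialDeriv_eq hg1 i) (Torus.repr x)
      rw [Torus.lift_apply, Torus.proj_repr] at h1
      rw [h1, hlift t ht]
      refine (ContinuousLinearMap.le_opNorm _ _).trans ?_
      have hn : ‖(EuclideanSpace.single i (1 : ℝ) : EuclideanSpace ℝ (Fin 3))‖ = 1 := by simp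
      rw [hn, mul_one]
      exact hD t ht _
    have hsum : ∑ i : Fin 3, ‖Torus.partialDeriv i (fun y => u t (Torus.repr y)) x‖ ^ 2 ≤ 3 * D ^ 2 :=
      calc ∑ i : Fin 3, ‖Torus.partialDeriv i (fun y => u t (Torus.repr y)) x‖ ^ 2
          ≤ ∑ _i : Fin 3, D ^ 2 :=
            Finset.sum_le_sum fun i _ => pow_le_pow_left₀ (norm_nonneg _) (hpt i) 2
        _ = 3 * D ^ 2 := by simp
    have h2 := torusVorticitySqAt_le_two_mul_sum_norm_sq (fun y => u t (Torus.repr y)) x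
    rw [Real.sq_sqrt (by positivity)]
    linarith
  · intro hbd u₀ hu₀ hdiv hper
    rcases clayPeriodic_solvable_or_gradientSupBlowup hμ hu₀ hdiv hper with
      hsol | ⟨Ts, hTs, u, p, hcl, hu0, hperT, -, -, hmax⟩
    · exact hsol
    · exfalso
      obtain ⟨Ω, hΩ⟩ := hbd u₀ hu₀ hdiv hper Ts u p hcl hu0 hperT
      obtain ⟨hU, -⟩ := torus_descend_of_periodic hcl hperT
      have hΩ' : ∀ t ∈ Ico 0 Ts, ∀ x, torusVorticitySqAt (fun y => u t (Torus.repr y)) x ≤ |Ω| ^ 2 :=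
        fun t ht x => (hΩ t ht x).trans_eq (sq_abs Ω).symm
      have hI : ∀ t ∈ Ico 0 Ts, ∫ _s in (0 : ℝ)..t, |Ω| ≤ |Ω| * Ts := by
        intro t ht
        rw [intervalIntegral.integral_const, smul_eq_mul, sub_zero, mul_comm]
        exact mul_le_mul_of_nonneg_left ht.2.le (abs_nonneg Ω)
      obtain ⟨T', hT', U', P', hU', hagree⟩ :=
        Torus.classicalNS_bkm_continuation_anyMean (d := Fin 3) (by simp) hμ hTs hU
          (M := fun _ => |Ω|) continuousOn_const (fun _ _ => abs_nonneg Ω) hΩ' hI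
      exact false_of_torus_continuation hTs hT' hu0 hper hmax hU' hagree

/-- **(B) ⇔ the a priori vorticity bound at every viscosity.**
[cite: FeffermanClay2006, (B) with (8) (10) (11) p. 2] [cite: BealeKatoMajda1984, Thm 1] -/
theorem clayPeriodic_regularity_iff_aprioriVorticityBound :
    clayPeriodic.Regularity ↔
      ∀ μ : ℝ, 0 < μ →
      ∀ (u₀ : EuclideanSpace ℝ (Fin 3) → EuclideanSpace ℝ (Fin 3)), ContDiff ℝ ∞ u₀ →
        NSWave0.IsDivFree u₀ → IsLatticePeriodic u₀ →
        ∀ (T : ℝ) (u : ℝ → EuclideanSpace ℝ (Fin 3) → EuclideanSpace ℝ (Fin 3))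
          (p : ℝ → EuclideanSpace ℝ (Fin 3) → ℝ),
          FluidPDE.IsClassicalNSSolutionOn (Ico 0 T) μ 0 u p → u 0 = u₀ →
          (∀ t ∈ Ico 0 T, IsLatticePeriodic (u t) ∧ IsLatticePeriodic (p t)) →
            ∃ Ω : ℝ, ∀ t ∈ Ico 0 T, ∀ x : UnitAddTorus (Fin 3),
              torusVorticitySqAt (fun y => u t (Torus.repr y)) x ≤ Ω ^ 2 :=
  ⟨fun h μ hμ => (clayPeriodic_regularityAt_iff_aprioriVorticityBound hμ).1 (h μ hμ),
    fun h μ hμ => (clayPeriodic_regularityAt_iff_aprioriVorticityBound hμ).2 (h μ hμ)⟩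

/-- **(B) ⇔ the a priori vorticity bound at ONE viscosity `μ > 0`.**
[cite: FeffermanClay2006, (B) p. 2] [cite: Tao2013Localisation, Rem. 1.2 footnote] -/
theorem clayPeriodic_regularity_iff_aprioriVorticityBound_at {μ : ℝ} (hμ : 0 < μ) :
    clayPeriodic.Regularity ↔
      ∀ (u₀ : EuclideanSpace ℝ (Fin 3) → EuclideanSpace ℝ (Fin 3)), ContDiff ℝ ∞ u₀ →
        NSWave0.IsDivFree u₀ → IsLatticePeriodic u₀ →
        ∀ (T : ℝ) (u : ℝ → EuclideanSpace ℝ (Fin 3) → EuclideanSpace ℝ (Fin 3))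
          (p : ℝ → EuclideanSpace ℝ (Fin 3) → ℝ),
          FluidPDE.IsClassicalNSSolutionOn (Ico 0 T) μ 0 u p → u 0 = u₀ →
          (∀ t ∈ Ico 0 T, IsLatticePeriodic (u t) ∧ IsLatticePeriodic (p t)) →
            ∃ Ω : ℝ, ∀ t ∈ Ico 0 T, ∀ x : UnitAddTorus (Fin 3),
              torusVorticitySqAt (fun y => u t (Torus.repr y)) x ≤ Ω ^ 2 := by
  rw [← ClaySpec.regularityAt_iff_regularity hμ clayPeriodic_data_smul
    clayPeriodic_admissible_timeRescale]
  exact clayPeriodic_regularityAt_iff_aprioriVorticityBound hμ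

/-! ## Per-datum doors with the `ℝ³` vorticity `curl` (rev 2, lit-4 g5) -/

/-- **Per-datum periodic Beale–Kato–Majda door, `ℝ³`-curl rendering**: for `ν > 0` and `u₀` smooth,
divergence free, `ℤ³`-periodic — if along EVERY classical solution `(u, p)` of the unforced system on a
half-open slab `[0, T) × ℝ³` with `u 0 = u₀` and `u(·,t)`, `p(·,t)` periodic, the vorticity
`|curl u(t,x)|` is bounded on `[0, T) × ℝ³`, then `(ν, 0, u₀)` is solvable in the printed class (10)
(the maximal periodic solution of `clayPeriodic_solvable_or_gradientSupBlowup` would continue past `T*`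
by the torus BKM door `Torus.classicalNS_bkm_continuation_anyMean`, the torus vorticity of the descended
slice being `|curl u(t)|²` at the lifted point, `Torus.norm_curl_lift_sq`).
[cite: FeffermanClay2006, (B) with (8) (10) (11) p. 2] [cite: BealeKatoMajda1984, Thm 1] [cite: RobinsonRodrigoSadowskiCUP2016, Thm 12.3, §6.3, §8.1] -/
theorem clayPeriodic_solvable_of_aprioriCurlBound_datum (hν : 0 < ν) (hu₀ : ContDiff ℝ ∞ u₀)
    (hdiv : NSWave0.IsDivFree u₀) (hper : IsLatticePeriodic u₀)
    (h : ∀ (T : ℝ) (u : ℝ → EuclideanSpace ℝ (Fin 3) → EuclideanSpace ℝ (Fin 3))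
      (p : ℝ → EuclideanSpace ℝ (Fin 3) → ℝ),
      FluidPDE.IsClassicalNSSolutionOn (Ico 0 T) ν 0 u p → u 0 = u₀ →
        (∀ t ∈ Ico 0 T, IsLatticePeriodic (u t) ∧ IsLatticePeriodic (p t)) →
          ∃ M : ℝ, ∀ t ∈ Ico 0 T, ∀ x : EuclideanSpace ℝ (Fin 3), ‖curl (u t) x‖ ≤ M) :
    clayPeriodic.Solvable ν 0 u₀ := by
  rcases clayPeriodic_solvable_or_gradientSupBlowup hν hu₀ hdiv hper with
    hsol | ⟨Ts, hTs, u, p, hcl, hu0, hperT, -, -, hmax⟩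
  · exact hsol
  · exfalso
    obtain ⟨M, hM⟩ := h Ts u p hcl hu0 hperT
    obtain ⟨hU, hlift⟩ := torus_descend_of_periodic hcl hperT
    have hΩ' : ∀ t ∈ Ico 0 Ts, ∀ x,
        torusVorticitySqAt (fun y => u t (Torus.repr y)) x ≤ |M| ^ 2 := by
      intro t ht x
      have h1 : Torus.IsContDiff 1 (fun y => u t (Torus.repr y)) :=
        (hU.smooth_velocity.isSmooth_slice ht).isContDiff (n := 1) (by exact_mod_cast le_top)
      have h2 := Torus.norm_curl_lift_sq h1 (Torus.repr x)
      rw [Torus.proj_repr, hlift t ht] at h2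
      rw [← h2]
      exact pow_le_pow_left₀ (norm_nonneg _) ((hM t ht _).trans (le_abs_self M)) 2
    have hI : ∀ t ∈ Ico 0 Ts, ∫ _s in (0 : ℝ)..t, |M| ≤ |M| * Ts := by
      intro t ht
      rw [intervalIntegral.integral_const, smul_eq_mul, sub_zero, mul_comm]
      exact mul_le_mul_of_nonneg_left ht.2.le (abs_nonneg M)
    obtain ⟨T', hT', U', P', hU', hagree⟩ :=
      Torus.classicalNS_bkm_continuation_anyMean (d := Fin 3) (by simp) hν hTs hU
        (M := fun _ => |M|) continuousOn_const (fun _ _ => abs_nonneg M) hΩ' hI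
    exact false_of_torus_continuation hTs hT' hu0 hper hmax hU' hagree

/-- **Per-datum periodic Serrin door**: a VELOCITY bound along every `u`,`p`-periodic classical solution
from `u₀` on every half-open slab gives printed-(10) solvability of `(ν, 0, u₀)`
(`not_clayPeriodic_solvable_iff_exists_velocitySupBlowup`).
[cite: FeffermanClay2006, (B) with (8) (10) (11) p. 2] [cite: RobinsonRodrigoSadowskiCUP2016, Thm 8.17 (r = 2, s = ∞), §6.3, §8.1] -/
theorem clayPeriodic_solvable_of_aprioriVelocityBound_datum (hν : 0 < ν) (hu₀ : ContDiff ℝ ∞ u₀)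
    (hdiv : NSWave0.IsDivFree u₀) (hper : IsLatticePeriodic u₀)
    (h : ∀ (T : ℝ) (u : ℝ → EuclideanSpace ℝ (Fin 3) → EuclideanSpace ℝ (Fin 3))
      (p : ℝ → EuclideanSpace ℝ (Fin 3) → ℝ),
      FluidPDE.IsClassicalNSSolutionOn (Ico 0 T) ν 0 u p → u 0 = u₀ →
        (∀ t ∈ Ico 0 T, IsLatticePeriodic (u t) ∧ IsLatticePeriodic (p t)) →
          ∃ M : ℝ, ∀ t ∈ Ico 0 T, ∀ x : EuclideanSpace ℝ (Fin 3), ‖u t x‖ ≤ M) :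
    clayPeriodic.Solvable ν 0 u₀ := by
  by_contra hno
  obtain ⟨T, -, u, p, hcl, hu0, hperT, hb⟩ :=
    (not_clayPeriodic_solvable_iff_exists_velocitySupBlowup hν hu₀ hdiv hper).1 hno
  obtain ⟨M, hM⟩ := h T u p hcl hu0 hperT
  obtain ⟨t, ht, x, hMx⟩ := hb M
  exact absurd hMx (not_lt.2 (hM t ht x))

/-- **(B) at one viscosity ⇔ the a priori `ℝ³`-VORTICITY bound** (`|curl u(t,x)| ≤ M` on
`[0, T) × ℝ³` along every `u`,`p`-periodic classical solution from a smooth divergence-free periodic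
datum; (⇒) `exists_bounds_of_clayPeriodic_solvable` and `|curl v| ≤ ‖curlCLM‖‖∇v‖`, (⇐)
`clayPeriodic_solvable_of_aprioriCurlBound_datum`).
[cite: FeffermanClay2006, (B) with (8) (10) (11) p. 2] [cite: BealeKatoMajda1984, Thm 1] -/
theorem clayPeriodic_regularityAt_iff_aprioriCurlBound {μ : ℝ} (hμ : 0 < μ) :
    clayPeriodic.RegularityAt μ ↔
      ∀ (u₀ : EuclideanSpace ℝ (Fin 3) → EuclideanSpace ℝ (Fin 3)), ContDiff ℝ ∞ u₀ →
        NSWave0.IsDivFree u₀ → IsLatticePeriodic u₀ →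
        ∀ (T : ℝ) (u : ℝ → EuclideanSpace ℝ (Fin 3) → EuclideanSpace ℝ (Fin 3))
          (p : ℝ → EuclideanSpace ℝ (Fin 3) → ℝ),
          FluidPDE.IsClassicalNSSolutionOn (Ico 0 T) μ 0 u p → u 0 = u₀ →
          (∀ t ∈ Ico 0 T, IsLatticePeriodic (u t) ∧ IsLatticePeriodic (p t)) →
            ∃ M : ℝ, ∀ t ∈ Ico 0 T, ∀ x : EuclideanSpace ℝ (Fin 3), ‖curl (u t) x‖ ≤ M := by
  constructor
  · intro hreg u₀ hu₀ hdiv hper T u p hcl hu0 hperT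
    obtain ⟨-, D, hD⟩ := exists_bounds_of_clayPeriodic_solvable hμ.le hcl hu0 hperT (hreg u₀ hu₀ hdiv hper)
    refine ⟨‖curlCLM‖ * D, fun t ht x => (norm_curl_le (u t) x).trans ?_⟩
    exact mul_le_mul_of_nonneg_left (hD t ht x) (ContinuousLinearMap.opNorm_nonneg curlCLM)
  · intro hbd u₀ hu₀ hdiv hper
    exact clayPeriodic_solvable_of_aprioriCurlBound_datum hμ hu₀ hdiv hper
      fun T u p hcl hu0 hperT => hbd u₀ hu₀ hdiv hper T u p hcl hu0 hperT

/-- **(B) ⇔ the a priori `ℝ³`-vorticity bound at ONE viscosity `μ > 0`.**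
[cite: FeffermanClay2006, (B) p. 2] [cite: Tao2013Localisation, Rem. 1.2 footnote] -/
theorem clayPeriodic_regularity_iff_aprioriCurlBound_at {μ : ℝ} (hμ : 0 < μ) :
    clayPeriodic.Regularity ↔
      ∀ (u₀ : EuclideanSpace ℝ (Fin 3) → EuclideanSpace ℝ (Fin 3)), ContDiff ℝ ∞ u₀ →
        NSWave0.IsDivFree u₀ → IsLatticePeriodic u₀ →
        ∀ (T : ℝ) (u : ℝ → EuclideanSpace ℝ (Fin 3) → EuclideanSpace ℝ (Fin 3))
          (p : ℝ → EuclideanSpace ℝ (Fin 3) → ℝ),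
          FluidPDE.IsClassicalNSSolutionOn (Ico 0 T) μ 0 u p → u 0 = u₀ →
          (∀ t ∈ Ico 0 T, IsLatticePeriodic (u t) ∧ IsLatticePeriodic (p t)) →
            ∃ M : ℝ, ∀ t ∈ Ico 0 T, ∀ x : EuclideanSpace ℝ (Fin 3), ‖curl (u t) x‖ ≤ M := by
  rw [← ClaySpec.regularityAt_iff_regularity hμ clayPeriodic_data_smul
    clayPeriodic_admissible_timeRescale]
  exact clayPeriodic_regularityAt_iff_aprioriCurlBound hμ

/-! ## (B) ⇔ the a priori Beale–Kato–Majda TIME-INTEGRAL bound; vorticity-integral certificates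
(rev 3, lit-4 g6) -/

/-- The curl of a `ℤ³`-periodic field is `ℤ³`-periodic (`curl = curlCLM ∘ D` and
`D(v(· + eⱼ))(x) = Dv(x + eⱼ)`). [folklore] -/
private theorem isLatticePeriodic_curl_of_periodic
    {v : EuclideanSpace ℝ (Fin 3) → EuclideanSpace ℝ (Fin 3)} (hv : IsLatticePeriodic v) :
    IsLatticePeriodic (curl v) := by
  intro j x
  rw [curl_eq_curlCLM, curl_eq_curlCLM, ← fderiv_comp_add_right,
    show (fun z => v (z + EuclideanSpace.single j 1)) = v from funext (hv j)]

/-- A continuous VORTICITY MAJORANT with bounded primitive along the maximal periodic solution contradicts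
its maximality (plumbing for the doors below): the descended torus solution would continue past `T*` by
the tree's Beale–Kato–Majda door `Torus.classicalNS_bkm_continuation_anyMean`, the torus vorticity of the
descended slice being `|curl u(t)|²` at the lifted point (`Torus.norm_curl_lift_sq`).
[cite: RobinsonRodrigoSadowskiCUP2016, Thm 12.3, §6.3, §8.1] [cite: BealeKatoMajda1984, Thm 1] -/
private theorem false_of_vorticityMajorant {Ts : ℝ} (hTs : 0 < Ts) (hν : 0 < ν)
    {u : ℝ → EuclideanSpace ℝ (Fin 3) → EuclideanSpace ℝ (Fin 3)} {p : ℝ → EuclideanSpace ℝ (Fin 3) → ℝ}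
    (hcl : FluidPDE.IsClassicalNSSolutionOn (Ico 0 Ts) ν 0 u p) (hu0 : u 0 = u₀)
    (hper₀ : IsLatticePeriodic u₀)
    (hperT : ∀ t ∈ Ico 0 Ts, IsLatticePeriodic (u t) ∧ IsLatticePeriodic (p t))
    (hmax : ∀ (b : ℝ) (v : ℝ → EuclideanSpace ℝ (Fin 3) → EuclideanSpace ℝ (Fin 3))
      (q : ℝ → EuclideanSpace ℝ (Fin 3) → ℝ),
      FluidPDE.IsClassicalNSSolutionOn (Icc 0 b) ν 0 v q → v 0 = u₀ →
      (∀ t ∈ Icc 0 b, IsLatticePeriodic (v t) ∧ IsLatticePeriodic (q t)) →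
        b < Ts ∧ ∀ s ∈ Icc 0 b, v s = u s)
    {M : ℝ → ℝ} (hMc : ContinuousOn M (Ico 0 Ts))
    (hM : ∀ t ∈ Ico 0 Ts, ∀ x : EuclideanSpace ℝ (Fin 3), ‖curl (u t) x‖ ≤ M t)
    {I : ℝ} (hI : ∀ t ∈ Ico 0 Ts, ∫ s in (0 : ℝ)..t, M s ≤ I) : False := by
  obtain ⟨hU, hlift⟩ := torus_descend_of_periodic hcl hperT
  have hM0 : ∀ t ∈ Ico 0 Ts, 0 ≤ M t := fun t ht => (norm_nonneg _).trans (hM t ht 0)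
  have hΩ' : ∀ t ∈ Ico 0 Ts, ∀ x,
      torusVorticitySqAt (fun y => u t (Torus.repr y)) x ≤ M t ^ 2 := by
    intro t ht x
    have h1 : Torus.IsContDiff 1 (fun y => u t (Torus.repr y)) :=
      (hU.smooth_velocity.isSmooth_slice ht).isContDiff (n := 1) (by exact_mod_cast le_top)
    have h2 := Torus.norm_curl_lift_sq h1 (Torus.repr x)
    rw [Torus.proj_repr, hlift t ht] at h2
    rw [← h2]
    exact pow_le_pow_left₀ (norm_nonneg _) (hM t ht _) 2
  obtain ⟨T', hT', U', P', hU', hagree⟩ :=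
    Torus.classicalNS_bkm_continuation_anyMean (d := Fin 3) (by simp) hν hTs hU hMc hM0 hΩ' hI
  exact false_of_torus_continuation hTs hT' hu0 hper₀ hmax hU' hagree

/-- **Per-datum periodic Beale–Kato–Majda door, MAJORANT form** (Robinson–Rodrigo–Sadowski 2016
Thm 12.3 as the tree renders it on `𝕋³`, `Torus.classicalNS_bkm_continuation_anyMean`): for `ν > 0` and
`u₀` smooth, divergence free, `ℤ³`-periodic — if along EVERY classical solution `(u, p)` of the unforced
system on a half-open slab `[0, T) × ℝ³` with `u 0 = u₀` and `u(·,t)`, `p(·,t)` periodic there is a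
continuous majorant `M` of the vorticity, `|curl u(t,x)| ≤ M(t)` on `[0, T) × ℝ³`, with bounded primitive
`∫₀ᵗ M ≤ I` (`0 ≤ t < T`), then `(ν, 0, u₀)` is solvable in the printed class (10) (the maximal periodic
solution of `clayPeriodic_solvable_or_gradientSupBlowup` would continue past `T*`).
[cite: FeffermanClay2006, (B) with (8) (10) (11) p. 2] [cite: BealeKatoMajda1984, Thm 1] [cite: RobinsonRodrigoSadowskiCUP2016, Thm 12.3 with (12.9), §6.3, §8.1] -/
theorem clayPeriodic_solvable_of_aprioriBKMMajorant_datum (hν : 0 < ν) (hu₀ : ContDiff ℝ ∞ u₀)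
    (hdiv : NSWave0.IsDivFree u₀) (hper : IsLatticePeriodic u₀)
    (h : ∀ (T : ℝ) (u : ℝ → EuclideanSpace ℝ (Fin 3) → EuclideanSpace ℝ (Fin 3))
      (p : ℝ → EuclideanSpace ℝ (Fin 3) → ℝ),
      FluidPDE.IsClassicalNSSolutionOn (Ico 0 T) ν 0 u p → u 0 = u₀ →
        (∀ t ∈ Ico 0 T, IsLatticePeriodic (u t) ∧ IsLatticePeriodic (p t)) →
          ∃ (M : ℝ → ℝ) (I : ℝ), ContinuousOn M (Ico 0 T) ∧
            (∀ t ∈ Ico 0 T, ∀ x : EuclideanSpace ℝ (Fin 3), ‖curl (u t) x‖ ≤ M t) ∧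
            ∀ t ∈ Ico 0 T, ∫ s in (0 : ℝ)..t, M s ≤ I) :
    clayPeriodic.Solvable ν 0 u₀ := by
  rcases clayPeriodic_solvable_or_gradientSupBlowup hν hu₀ hdiv hper with
    hsol | ⟨Ts, hTs, u, p, hcl, hu0, hperT, -, -, hmax⟩
  · exact hsol
  · exfalso
    obtain ⟨M, I, hMc, hM, hI⟩ := h Ts u p hcl hu0 hperT
    exact false_of_vorticityMajorant hTs hν hcl hu0 hper hperT hmax hMc hM hI

/-- **A finite Beale–Kato–Majda integral along a periodic classical solution yields a continuous
vorticity majorant with bounded primitive.** If `(u, p)` is a classical solution of the unforced system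
on `[0, T) × ℝ³` with `u(·,t)`, `p(·,t)` `ℤ³`-periodic and `∫₀ᵀ sup_x |curl u(t,x)| dt < ∞` (lower
Lebesgue integral of the `[0,∞]`-valued supremum), then `M(t) = ‖curl u(t)‖_{L^∞}` — the quantity
(12.9) of Robinson–Rodrigo–Sadowski integrates; continuous on `[0, T)` as the sup over the compact torus
of the jointly continuous descended vorticity, tree `Torus.IsSmoothSpaceTimeOn.continuousOn_toReal_eSupNorm`
— majorises `|curl u|` on `[0, T) × ℝ³` and `∫₀ᵗ M ≤ ∫₀ᵀ sup_x |curl u| < ∞` for `0 ≤ t < T`.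
[cite: RobinsonRodrigoSadowskiCUP2016, Thm 12.3 (12.9)] [cite: BealeKatoMajda1984, Thm 1] -/
theorem exists_vorticityMajorant_of_lintegral_ne_top {T : ℝ}
    {u : ℝ → EuclideanSpace ℝ (Fin 3) → EuclideanSpace ℝ (Fin 3)} {p : ℝ → EuclideanSpace ℝ (Fin 3) → ℝ}
    (hcl : FluidPDE.IsClassicalNSSolutionOn (Ico 0 T) ν 0 u p)
    (hper : ∀ t ∈ Ico 0 T, IsLatticePeriodic (u t) ∧ IsLatticePeriodic (p t))
    (hfin : (∫⁻ t in Ioo 0 T, ⨆ x : EuclideanSpace ℝ (Fin 3), ‖curl (u t) x‖ₑ) ≠ ⊤) :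
    ∃ (M : ℝ → ℝ) (I : ℝ), ContinuousOn M (Ico 0 T) ∧
      (∀ t ∈ Ico 0 T, ∀ x : EuclideanSpace ℝ (Fin 3), ‖curl (u t) x‖ ≤ M t) ∧
      ∀ t ∈ Ico 0 T, ∫ s in (0 : ℝ)..t, M s ≤ I := by
  have hS : UniqueDiffOn ℝ (Ico (0 : ℝ) T) := uniqueDiffOn_Ico 0 T
  -- periodicity of the vorticity slices: `curl u(t, repr (proj y)) = curl u(t, y)`
  have hrepr : ∀ t ∈ Ico 0 T, ∀ y : EuclideanSpace ℝ (Fin 3),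
      curl (u t) (Torus.repr (Torus.proj y)) = curl (u t) y := by
    intro t ht y
    have h := congrFun (Torus.lift_descend_holds (curl (u t))
      (isLatticePeriodic_curl_of_periodic (hper t ht).1)) y
    rwa [Torus.lift_apply, Torus.descend_apply] at h
  -- the descended vorticity `(t, x) ↦ curl u(t, repr x)` is jointly smooth on `[0, T) × 𝕋³`
  have hcurl : ContDiffOn ℝ ∞ (uncurry fun t x => curl (u t) x) (Ico 0 T ×ˢ univ) := by
    have hD := hcl.smooth_velocity.fderiv_slice hS
    have heq : (uncurry fun t x => curl (u t) x) =
        (curlCLM : (EuclideanSpace ℝ (Fin 3) →L[ℝ] EuclideanSpace ℝ (Fin 3)) →L[ℝ]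
          EuclideanSpace ℝ (Fin 3)) ∘ (uncurry fun t x => fderiv ℝ (u t) x) := by
      funext z
      rfl
    rw [heq]
    exact curlCLM.contDiff.comp_contDiffOn hD
  have hWs : Torus.IsSmoothSpaceTimeOn (Ico 0 T)
      (fun t (x : UnitAddTorus (Fin 3)) => curl (u t) (Torus.repr x)) := by
    show ContDiffOn ℝ ∞ (Torus.stLift fun t (x : UnitAddTorus (Fin 3)) => curl (u t) (Torus.repr x))
      (Ico 0 T ×ˢ univ)
    refine hcurl.congr fun q hq => ?_
    show curl (u q.1) (Torus.repr (Torus.proj q.2)) = curl (u q.1) q.2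
    exact hrepr q.1 (mem_prod.1 hq).1 q.2
  -- pointwise comparison `ofReal ‖curl u(s)‖_{L^∞(𝕋³)} ≤ sup_x ‖curl u(s, x)‖ₑ` (all `s`)
  have hpt : ∀ s, ENNReal.ofReal
      (eSupNorm (fun x : UnitAddTorus (Fin 3) => curl (u s) (Torus.repr x))).toReal ≤
        ⨆ x : EuclideanSpace ℝ (Fin 3), ‖curl (u s) x‖ₑ := fun s =>
    ENNReal.ofReal_toReal_le.trans (iSup_le fun x =>
      le_iSup (fun y : EuclideanSpace ℝ (Fin 3) => ‖curl (u s) y‖ₑ) (Torus.repr x))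
  refine ⟨fun t => (eSupNorm (fun x : UnitAddTorus (Fin 3) => curl (u t) (Torus.repr x))).toReal,
    (∫⁻ t in Ioo 0 T, ⨆ x : EuclideanSpace ℝ (Fin 3), ‖curl (u t) x‖ₑ).toReal,
    hWs.continuousOn_toReal_eSupNorm, fun t ht y => ?_, fun t ht => ?_⟩
  · -- the majorant: `|curl u(t, y)| = |W(t, proj y)| ≤ ‖W(t)‖_∞`
    have h1 := Torus.norm_le_toReal_eSupNorm (hWs.isSmooth_slice ht).continuous (Torus.proj y)
    simpa only [hrepr t ht y] using h1
  · -- the primitive: `∫₀ᵗ M = ∫⁻_{(0,t]} ofReal M ≤ ∫⁻_{(0,T)} sup_x ‖curl u‖ₑ`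
    have hMc' : ContinuousOn
        (fun s => (eSupNorm (fun x : UnitAddTorus (Fin 3) => curl (u s) (Torus.repr x))).toReal)
        (Icc 0 t) :=
      hWs.continuousOn_toReal_eSupNorm.mono fun s hs => ⟨hs.1, hs.2.trans_lt ht.2⟩
    have hint : IntegrableOn
        (fun s => (eSupNorm (fun x : UnitAddTorus (Fin 3) => curl (u s) (Torus.repr x))).toReal)
        (Ioc 0 t) :=
      hMc'.integrableOn_Icc.mono_set Ioc_subset_Icc_self
    rw [intervalIntegral.integral_of_le ht.1]
    refine (ENNReal.ofReal_le_iff_le_toReal hfin).1 ?_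
    rw [ofReal_integral_eq_lintegral_ofReal hint (ae_of_all _ fun s => ENNReal.toReal_nonneg)]
    calc ∫⁻ s in Ioc 0 t, ENNReal.ofReal
          (eSupNorm (fun x : UnitAddTorus (Fin 3) => curl (u s) (Torus.repr x))).toReal
        ≤ ∫⁻ s in Ioc 0 t, ⨆ x : EuclideanSpace ℝ (Fin 3), ‖curl (u s) x‖ₑ :=
          lintegral_mono fun s => hpt s
      _ ≤ ∫⁻ s in Ioo 0 T, ⨆ x : EuclideanSpace ℝ (Fin 3), ‖curl (u s) x‖ₑ :=
          lintegral_mono_set (Ioc_subset_Ioo_right ht.2)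

/-- **A periodic Beale–Kato–Majda TIME-INTEGRAL blow-up certificate excludes printed-(10) solvability**:
a classical solution of the unforced system on `ℝ³ × [0, T)` with `u(0) = u₀`, `u(·,t)`, `p(·,t)`
`ℤ³`-periodic, and `∫₀ᵀ sup_x |curl u(t,x)| dt = ∞` ⇒ `(ν, 0, u₀)` has no solution smooth on
`ℝ³ × [0,∞)` with periodic velocity (pointwise `|curl v| ≤ ‖curlCLM‖ ‖∇v‖`, `norm_curl_le`, and the
gradient-integral certificate `not_clayPeriodic_solvable_of_blowupCertificate`).
[cite: FeffermanClay2006, (D) with (10) (11) p. 2] [cite: BealeKatoMajda1984, Thm 1] [cite: Tao2013Localisation, Prop. 1.7 and §2] -/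
theorem not_clayPeriodic_solvable_of_vorticityIntegralCertificate {T : ℝ} (hν : 0 ≤ ν)
    {u : ℝ → EuclideanSpace ℝ (Fin 3) → EuclideanSpace ℝ (Fin 3)} {p : ℝ → EuclideanSpace ℝ (Fin 3) → ℝ}
    (hcl : FluidPDE.IsClassicalNSSolutionOn (Ico 0 T) ν 0 u p) (hu0 : u 0 = u₀)
    (hper : ∀ t ∈ Ico 0 T, IsLatticePeriodic (u t) ∧ IsLatticePeriodic (p t))
    (hblow : (∫⁻ t in Ioo 0 T, ⨆ x : EuclideanSpace ℝ (Fin 3), ‖curl (u t) x‖ₑ) = ⊤) :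
    ¬ clayPeriodic.Solvable ν 0 u₀ := by
  refine not_clayPeriodic_solvable_of_blowupCertificate hν hcl hu0 hper ?_
  have hpt : ∀ t (x : EuclideanSpace ℝ (Fin 3)),
      ‖curl (u t) x‖ₑ ≤ ENNReal.ofReal ‖curlCLM‖ * ‖fderiv ℝ (u t) x‖ₑ := by
    intro t x
    calc ‖curl (u t) x‖ₑ = ENNReal.ofReal ‖curl (u t) x‖ := (ofReal_norm _).symm
      _ ≤ ENNReal.ofReal (‖curlCLM‖ * ‖fderiv ℝ (u t) x‖) :=
          ENNReal.ofReal_le_ofReal (norm_curl_le (u t) x)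
      _ = ENNReal.ofReal ‖curlCLM‖ * ‖fderiv ℝ (u t) x‖ₑ := by
          rw [ENNReal.ofReal_mul (norm_nonneg curlCLM), ofReal_norm, ofReal_norm]
  have hsup : ∀ t, (⨆ x : EuclideanSpace ℝ (Fin 3), ‖curl (u t) x‖ₑ) ≤
      ENNReal.ofReal ‖curlCLM‖ * ⨆ x : EuclideanSpace ℝ (Fin 3), ‖fderiv ℝ (u t) x‖ₑ := fun t =>
    iSup_le fun x => (hpt t x).trans
      (mul_le_mul' le_rfl (le_iSup (fun y : EuclideanSpace ℝ (Fin 3) => ‖fderiv ℝ (u t) y‖ₑ) x))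
  by_contra hfin
  have hlt : (∫⁻ t in Ioo 0 T, ⨆ x : EuclideanSpace ℝ (Fin 3), ‖curl (u t) x‖ₑ) < ⊤ :=
    calc (∫⁻ t in Ioo 0 T, ⨆ x : EuclideanSpace ℝ (Fin 3), ‖curl (u t) x‖ₑ)
        ≤ ∫⁻ t in Ioo 0 T, ENNReal.ofReal ‖curlCLM‖ *
            ⨆ x : EuclideanSpace ℝ (Fin 3), ‖fderiv ℝ (u t) x‖ₑ := lintegral_mono fun t => hsup t
      _ = ENNReal.ofReal ‖curlCLM‖ *
            ∫⁻ t in Ioo 0 T, ⨆ x : EuclideanSpace ℝ (Fin 3), ‖fderiv ℝ (u t) x‖ₑ :=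
          lintegral_const_mul' _ _ ENNReal.ofReal_ne_top
      _ < ⊤ := ENNReal.mul_lt_top ENNReal.ofReal_lt_top (lt_top_iff_ne_top.2 hfin)
  exact hlt.ne hblow

/-- **Printed-(10) solvability of one periodic Cauchy problem fails iff its classical solution has a
divergent Beale–Kato–Majda integral in finite time**: for `ν > 0` and `u₀` smooth, divergence free,
`ℤ³`-periodic, `¬ clayPeriodic.Solvable ν 0 u₀ ↔ ∃ T > 0, ∃ (u, p)` classical on `[0, T) × ℝ³`,
`u 0 = u₀`, `u(·,t)`, `p(·,t)` periodic, `∫₀ᵀ sup_x |curl u(t,x)| dt = ∞` ((⇒): along the maximal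
solution of `clayPeriodic_solvable_or_gradientSupBlowup` a finite integral would give a continuous
majorant, `exists_vorticityMajorant_of_lintegral_ne_top`, and continue it past `T*`; (⇐) is
`not_clayPeriodic_solvable_of_vorticityIntegralCertificate`).
[cite: FeffermanClay2006, (B) (D) with (8) (10) (11) p. 2] [cite: BealeKatoMajda1984, Thm 1] [cite: RobinsonRodrigoSadowskiCUP2016, Thm 12.3, §6.3, §8.1] -/
theorem not_clayPeriodic_solvable_iff_exists_bkmBlowup (hν : 0 < ν) (hu₀ : ContDiff ℝ ∞ u₀)
    (hdiv : NSWave0.IsDivFree u₀) (hper : IsLatticePeriodic u₀) :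
    ¬ clayPeriodic.Solvable ν 0 u₀ ↔
      ∃ T : ℝ, 0 < T ∧
        ∃ (u : ℝ → EuclideanSpace ℝ (Fin 3) → EuclideanSpace ℝ (Fin 3))
          (p : ℝ → EuclideanSpace ℝ (Fin 3) → ℝ),
          FluidPDE.IsClassicalNSSolutionOn (Ico 0 T) ν 0 u p ∧ u 0 = u₀ ∧
          (∀ t ∈ Ico 0 T, IsLatticePeriodic (u t) ∧ IsLatticePeriodic (p t)) ∧
          (∫⁻ t in Ioo 0 T, ⨆ x : EuclideanSpace ℝ (Fin 3), ‖curl (u t) x‖ₑ) = ⊤ := by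
  constructor
  · intro hno
    rcases clayPeriodic_solvable_or_gradientSupBlowup hν hu₀ hdiv hper with
      hsol | ⟨Ts, hTs, u, p, hcl, hu0, hperT, -, -, hmax⟩
    · exact absurd hsol hno
    · refine ⟨Ts, hTs, u, p, hcl, hu0, hperT, ?_⟩
      by_contra hfin
      obtain ⟨M, I, hMc, hM, hI⟩ := exists_vorticityMajorant_of_lintegral_ne_top hcl hperT hfin
      exact false_of_vorticityMajorant hTs hν hcl hu0 hper hperT hmax hMc hM hI
  · rintro ⟨T, -, u, p, hcl, hu0, hperT, hblow⟩
    exact not_clayPeriodic_solvable_of_vorticityIntegralCertificate hν.le hcl hu0 hperT hblow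

/-- **Per-datum periodic Beale–Kato–Majda door, TIME-INTEGRAL form**: for `ν > 0` and `u₀` smooth,
divergence free, `ℤ³`-periodic — if along every `u`,`p`-periodic classical solution from `u₀` on every
half-open slab `[0, T) × ℝ³` the Beale–Kato–Majda integral `∫₀ᵀ sup_x |curl u(t,x)| dt` is finite, then
`(ν, 0, u₀)` is solvable in the printed class (10).
[cite: FeffermanClay2006, (B) with (8) (10) (11) p. 2] [cite: BealeKatoMajda1984, Thm 1] [cite: RobinsonRodrigoSadowskiCUP2016, Thm 12.3, §6.3, §8.1] -/
theorem clayPeriodic_solvable_of_aprioriBKM_datum (hν : 0 < ν) (hu₀ : ContDiff ℝ ∞ u₀)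
    (hdiv : NSWave0.IsDivFree u₀) (hper : IsLatticePeriodic u₀)
    (h : ∀ (T : ℝ) (u : ℝ → EuclideanSpace ℝ (Fin 3) → EuclideanSpace ℝ (Fin 3))
      (p : ℝ → EuclideanSpace ℝ (Fin 3) → ℝ),
      FluidPDE.IsClassicalNSSolutionOn (Ico 0 T) ν 0 u p → u 0 = u₀ →
        (∀ t ∈ Ico 0 T, IsLatticePeriodic (u t) ∧ IsLatticePeriodic (p t)) →
          (∫⁻ t in Ioo 0 T, ⨆ x : EuclideanSpace ℝ (Fin 3), ‖curl (u t) x‖ₑ) < ⊤) :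
    clayPeriodic.Solvable ν 0 u₀ := by
  by_contra hno
  obtain ⟨T, -, u, p, hcl, hu0, hperT, hblow⟩ :=
    (not_clayPeriodic_solvable_iff_exists_bkmBlowup hν hu₀ hdiv hper).1 hno
  exact (h T u p hcl hu0 hperT).ne hblow

/-- **(B) at one viscosity ⇔ the a priori Beale–Kato–Majda bound**: `clayPeriodic.RegularityAt μ` ⇔
every `u`,`p`-periodic classical solution of the unforced system on a half-open slab `[0, T) × ℝ³` from a
smooth divergence-free `ℤ³`-periodic datum has `∫₀ᵀ ‖curl u(t)‖_{L^∞} dt < ∞` — the periodic twin of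
`clayR3_regularityAt_iff_aprioriBKM` ((⇒) `not_clayPeriodic_solvable_of_vorticityIntegralCertificate`;
(⇐) `clayPeriodic_solvable_of_aprioriBKM_datum`).
[cite: FeffermanClay2006, (B) with (8) (10) (11) p. 2] [cite: BealeKatoMajda1984, Thm 1 and Corollary] [cite: RobinsonRodrigoSadowskiCUP2016, Thm 12.3] -/
theorem clayPeriodic_regularityAt_iff_aprioriBKM {μ : ℝ} (hμ : 0 < μ) :
    clayPeriodic.RegularityAt μ ↔
      ∀ (u₀ : EuclideanSpace ℝ (Fin 3) → EuclideanSpace ℝ (Fin 3)), ContDiff ℝ ∞ u₀ →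
        NSWave0.IsDivFree u₀ → IsLatticePeriodic u₀ →
        ∀ (T : ℝ) (u : ℝ → EuclideanSpace ℝ (Fin 3) → EuclideanSpace ℝ (Fin 3))
          (p : ℝ → EuclideanSpace ℝ (Fin 3) → ℝ),
          FluidPDE.IsClassicalNSSolutionOn (Ico 0 T) μ 0 u p → u 0 = u₀ →
          (∀ t ∈ Ico 0 T, IsLatticePeriodic (u t) ∧ IsLatticePeriodic (p t)) →
            (∫⁻ t in Ioo 0 T, ⨆ x : EuclideanSpace ℝ (Fin 3), ‖curl (u t) x‖ₑ) < ⊤ := by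
  constructor
  · intro hreg u₀ hu₀ hdiv hper T u p hcl hu0 hperT
    exact lt_top_iff_ne_top.2 fun htop =>
      not_clayPeriodic_solvable_of_vorticityIntegralCertificate hμ.le hcl hu0 hperT htop
        (hreg u₀ hu₀ hdiv hper)
  · intro hbkm u₀ hu₀ hdiv hper
    exact clayPeriodic_solvable_of_aprioriBKM_datum hμ hu₀ hdiv hper
      fun T u p hcl hu0 hperT => hbkm u₀ hu₀ hdiv hper T u p hcl hu0 hperT

/-- **(B) ⇔ the a priori Beale–Kato–Majda bound at every viscosity.**
[cite: FeffermanClay2006, (B) with (8) (10) (11) p. 2] [cite: BealeKatoMajda1984, Thm 1 and Corollary] -/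
theorem clayPeriodic_regularity_iff_aprioriBKM :
    clayPeriodic.Regularity ↔
      ∀ μ : ℝ, 0 < μ →
      ∀ (u₀ : EuclideanSpace ℝ (Fin 3) → EuclideanSpace ℝ (Fin 3)), ContDiff ℝ ∞ u₀ →
        NSWave0.IsDivFree u₀ → IsLatticePeriodic u₀ →
        ∀ (T : ℝ) (u : ℝ → EuclideanSpace ℝ (Fin 3) → EuclideanSpace ℝ (Fin 3))
          (p : ℝ → EuclideanSpace ℝ (Fin 3) → ℝ),
          FluidPDE.IsClassicalNSSolutionOn (Ico 0 T) μ 0 u p → u 0 = u₀ →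
          (∀ t ∈ Ico 0 T, IsLatticePeriodic (u t) ∧ IsLatticePeriodic (p t)) →
            (∫⁻ t in Ioo 0 T, ⨆ x : EuclideanSpace ℝ (Fin 3), ‖curl (u t) x‖ₑ) < ⊤ :=
  ⟨fun h μ hμ => (clayPeriodic_regularityAt_iff_aprioriBKM hμ).1 (h μ hμ),
    fun h μ hμ => (clayPeriodic_regularityAt_iff_aprioriBKM hμ).2 (h μ hμ)⟩

/-- **(B) ⇔ the a priori Beale–Kato–Majda bound at ONE viscosity `μ > 0`.**
[cite: FeffermanClay2006, (B) p. 2] [cite: BealeKatoMajda1984, Thm 1 and Corollary] [cite: Tao2013Localisation, Rem. 1.2 footnote] -/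
theorem clayPeriodic_regularity_iff_aprioriBKM_at {μ : ℝ} (hμ : 0 < μ) :
    clayPeriodic.Regularity ↔
      ∀ (u₀ : EuclideanSpace ℝ (Fin 3) → EuclideanSpace ℝ (Fin 3)), ContDiff ℝ ∞ u₀ →
        NSWave0.IsDivFree u₀ → IsLatticePeriodic u₀ →
        ∀ (T : ℝ) (u : ℝ → EuclideanSpace ℝ (Fin 3) → EuclideanSpace ℝ (Fin 3))
          (p : ℝ → EuclideanSpace ℝ (Fin 3) → ℝ),
          FluidPDE.IsClassicalNSSolutionOn (Ico 0 T) μ 0 u p → u 0 = u₀ →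
          (∀ t ∈ Ico 0 T, IsLatticePeriodic (u t) ∧ IsLatticePeriodic (p t)) →
            (∫⁻ t in Ioo 0 T, ⨆ x : EuclideanSpace ℝ (Fin 3), ‖curl (u t) x‖ₑ) < ⊤ := by
  rw [← ClaySpec.regularityAt_iff_regularity hμ clayPeriodic_data_smul
    clayPeriodic_admissible_timeRescale]
  exact clayPeriodic_regularityAt_iff_aprioriBKM hμ

/-- **One periodic Beale–Kato–Majda time-integral blow-up certificate at one viscosity `ν > 0` proves
Clay (D) as printed** (leaf `NavierStokesBreakdownPeriodic`, at every viscosity, via the Δ5/Δ7 bridges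
`clayPeriodic_solvable_zero_iff_errata`, `navierStokesBreakdownPeriodic_of_not_errataSolvable_zero`); the
datum must be smooth, divergence free and `ℤ³`-periodic.
[cite: FeffermanClay2006, (D) p. 2] [cite: BealeKatoMajda1984, Thm 1] [cite: Tao2013Localisation, Prop. 1.7 and Rem. 1.2 footnote] -/
theorem navierStokesBreakdownPeriodic_of_vorticityIntegralCertificate {T : ℝ} (hν : 0 < ν)
    (hu₀ : ContDiff ℝ ∞ u₀) (hdiv : NSWave0.IsDivFree u₀) (hper₀ : IsLatticePeriodic u₀)
    {u : ℝ → EuclideanSpace ℝ (Fin 3) → EuclideanSpace ℝ (Fin 3)} {p : ℝ → EuclideanSpace ℝ (Fin 3) → ℝ}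
    (hcl : FluidPDE.IsClassicalNSSolutionOn (Ico 0 T) ν 0 u p) (hu0 : u 0 = u₀)
    (hper : ∀ t ∈ Ico 0 T, IsLatticePeriodic (u t) ∧ IsLatticePeriodic (p t))
    (hblow : (∫⁻ t in Ioo 0 T, ⨆ x : EuclideanSpace ℝ (Fin 3), ‖curl (u t) x‖ₑ) = ⊤) :
    Summit.NavierStokesRegularity.NavierStokesRegularity.NavierStokesBreakdownPeriodic :=
  navierStokesBreakdownPeriodic_of_not_errataSolvable_zero hν hu₀ hdiv hper₀ fun h =>
    not_clayPeriodic_solvable_of_vorticityIntegralCertificate hν.le hcl hu0 hper hblow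
      ((clayPeriodic_solvable_zero_iff_errata ν u₀).2 h)

end

end Literature.Claims.NS.ClayVariants

-- WHAT THIS IS NOT: not a claim about NS regularity or blow-up; not a claim about any author beyond
-- the typed locator.
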